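import Summits.BirchSwinnertonDyer.BirchSwinnertonDyer.Theses.MordellShaFreeCut
import Literature.NumberTheory.EllipticCurves.HeegnerFieldDescentProofs
import Literature.NumberTheory.EllipticCurves.BSDHeegnerPoints
import Literature.NumberTheory.EllipticCurves.BSDInvariantsProofs
import Literature.NumberTheory.EllipticCurves.GlobalMinimalModelProofs
import Literature.NumberTheory.EllipticCurves.BSDQuadraticDescentShaOddPartGeneralProofs
import Literature.NumberTheory.EllipticCurves.AnalyticRankModularityProofs

set_option linter.dupNamespace false
set_option autoImplicit false

/-! # Route `MordellShaFreeCut` (rung S2b) — crux `AnalyticRankOneOfRankOneFiniteShaThree`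
(stmt-BirchSwinnertonDyer-19160) modulo ONE `ℚ`-level Heegner-point statement: the alternative BC3
cut v2 with its three companions discharged, and the cut is faithful

Plan g9's alternative cut of crux B (`HOME/bsd-cn100-plan/routes-g9/bc/AnalyticRankOneOfRankOneFiniteShaThree_birth_v2.lean`,
sha16 3ae55b3d165becbf; line `heegner-field-gz`; NOT registered — the g8 skeleton f9a75e4a is of
record) composes `stub_minimalModelReduction`, `stub_heegnerFieldSupply`, `stub_heegnerNonTorsion`
(research, `ℚ`-level, Heegner-point-shaped: Fan–Wan v2 Thm. 6.9 shape at the ADDITIVE prime `3` of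
the `j = 0` curves) and `stub_grossZagierCloser` into the crux. This file

1. PROVES `stub_minimalModelReduction` outright, with the v2 signature token for token (Néron's
   global minimal model `hasGlobalMinimalModel_rat_holds`; `j`, rank, finiteness of `Ш[3^∞]` and
   `ord_{s=1} L` are invariant under changes of variables: Mathlib `variableChange_j`, tree theorems
   `mordellWeilRank_variableChange_holds`, `finite_primaryComponent_sha_variableChange`,
   `analyticRank_variableChange_holds`);
2. proves `stub_heegnerFieldSupply` modulo the four refereed facts of the landed descent theorem
   `exists_heegnerField_descent_of_mordellWeilRank_eq_one_of_finite_sha` (p411267: `p_parity`,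
   Modularity, Hoffstein–Luo, Kato) — `heegnerFieldSupply_of_facts`;
3. proves `stub_grossZagierCloser` modulo the two refereed facts `exists_isHeegnerPoint` (Gross
   1984 / Gross–Zagier I.§4) and `analyticRankEK_eq_one_iff_heegner_nonTorsion` (Gross–Zagier 1986
   Thm. I.6.3 + Kolyvagin) — `grossZagierCloser_of_facts`;
4. runs the v2 composition with 1–3 in place: crux B from those six refereed facts and the research
   stub `stub_heegnerNonTorsion` carried verbatim as ONE hypothesis —
   `analyticRankOne_of_facts_of_heegnerNonTorsion`;
5. conversely derives the research stub from crux B modulo Modularity and Gross–Zagier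
   (`heegnerNonTorsion_of_crux`; every elliptic `W/ℚ` with `j = 0` is `ℚ`-isomorphic to a Mordell
   curve: short normal form with `c₄ = −48 a₄ = 0`, `exists_variableChange_eq_mordellCurve_of_j_eq_zero`),
   so the v2 research stub, like the `K`-level stub of the cut of record
   (`MordellShaFreeCutOfThreeConverseOverK.threeConverseOverK_iff_crux_of_facts`), is EQUIVALENT to
   the item modulo refereed facts: a faithful last-step formulation, naming the object — a
   non-torsion Heegner point over an auxiliary `K` with `3` split — that an auxiliary-field proof
   would produce. Supports, does not close, stmt-BirchSwinnertonDyer-19160. -/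

noncomputable section

open scoped Classical

namespace Summit.BirchSwinnertonDyer.BirchSwinnertonDyer.Theorems.MordellShaFreeCutOfHeegnerNonTorsion

open Literature.NumberTheory.EllipticCurves WeierstrassCurve
open Summit.BirchSwinnertonDyer.BirchSwinnertonDyer.Theses.MordellShaFreeCut

/-! ## 1. `stub_minimalModelReduction` — proved -/

/-- **`stub_minimalModelReduction` of the v2 cut, PROVED** (signature token for token): if every
globally minimal elliptic `W/ℚ` with `j(W) = 0`, `rank W(ℚ) = 1` and `#Ш(W/ℚ)[3^∞] < ∞` has
`ord_{s=1} L(W, s) = 1`, then so does every Mordell curve `E_D`, `D ≠ 0`. Proof: a global minimal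
model `C • E_D` exists (Néron 1964 / Silverman VIII.8.3, tree theorem `hasGlobalMinimalModel_rat_holds`);
`j(C • E_D) = j(E_D) = 0` (`variableChange_j`, `c₄(E_D) = 0`); rank, finiteness of `Ш[3^∞]` and the
analytic rank pass along `C` (`mordellWeilRank_variableChange_holds`,
`finite_primaryComponent_sha_variableChange`, `analyticRank_variableChange_holds`).
[cite: SilvermanAEC2009, VIII.8 Cor. 8.3, X.§4, App. C §16] -/
theorem stub_minimalModelReduction :
    (∀ (W : WeierstrassCurve ℚ) [W.IsElliptic] [W.IsGloballyMinimal], W.j = 0 →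
        W.mordellWeilRank = 1 → Finite (AddCommGroup.primaryComponent W.sha 3) →
          W.analyticRank = 1) →
      ∀ ⦃D : ℚ⦄, D ≠ 0 → (mordellCurve D).mordellWeilRank = 1 →
        Finite (AddCommGroup.primaryComponent (mordellCurve D).sha 3) →
          (mordellCurve D).analyticRank = 1 := by
  intro h D hD hr hfin
  haveI := isElliptic_mordellCurve hD
  obtain ⟨C, hmin⟩ := hasGlobalMinimalModel_rat_holds (mordellCurve D)
  haveI : (C • mordellCurve D).IsGloballyMinimal := hmin
  have hj : (C • mordellCurve D).j = 0 := by
    rw [variableChange_j]; exact (mordellCurve D).j_eq_zero (mordellCurve_c₄ _)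
  have hr' : (C • mordellCurve D).mordellWeilRank = 1 := by
    rw [mordellWeilRank_variableChange_holds]; exact hr
  haveI := hfin
  have hfin' : Finite (AddCommGroup.primaryComponent (C • mordellCurve D).sha 3) :=
    WeierstrassCurve.finite_primaryComponent_sha_variableChange (mordellCurve D) C 3
  have h1 := h (C • mordellCurve D) hj hr' hfin'
  rwa [analyticRank_variableChange_holds (mordellCurve D) C] at h1

/-! ## 2. `stub_heegnerFieldSupply` — modulo four refereed facts -/

/-- **`stub_heegnerFieldSupply` of the v2 cut from refereed facts** (statement after the binders =
the stub, token for token): for elliptic `W/ℚ` with `rank W(ℚ) = 1` and `#Ш(W/ℚ)[3^∞] < ∞` there is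
an imaginary quadratic `K` with the Heegner hypothesis for `N(W)` and for `3`, `L(W^{(d_K)}, 1) ≠ 0`
and `ord_{s=1} L(W/K, s) = ord_{s=1} L(W, s)` — granted `3`-parity (`hpar`), Modularity (`hmod`),
Hoffstein–Luo (`hHL`) and Kato (`hKato`): the landed
`exists_heegnerField_descent_of_mordellWeilRank_eq_one_of_finite_sha` (p411267) with four conjuncts
dropped. [cite: HoffsteinLuo1997, Theorem (§1)] [cite: Kato2004Asterisque, Cor. 14.3]
[cite: DokchitserDokchitserAnnals2010, Thm. 1.4] -/
theorem heegnerFieldSupply_of_facts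
    (hpar : ∀ (W : WeierstrassCurve ℚ) [W.IsElliptic] (p : ℕ) [Fact p.Prime], p_parity W p)
    (hmod : ModularForms.exists_isNewformOf) (hHL : HoffsteinLuo1997_exists_twist_L_one_ne_zero)
    (hKato : ∀ (W : WeierstrassCurve ℚ) [W.IsElliptic] (p : ℕ) [Fact p.Prime],
      kato_finite_of_L_one_ne_zero W p) :
    ∀ (W : WeierstrassCurve ℚ) [W.IsElliptic], W.mordellWeilRank = 1 →
      Finite (AddCommGroup.primaryComponent W.sha 3) →
        ∃ (K : Type) (_ : Field K) (_ : NumberField K),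
          IsImaginaryQuadratic K ∧ SatisfiesHeegnerHypothesis (W.conductorNorm ℤ) K ∧
            SatisfiesHeegnerHypothesis 3 K ∧
              (W.quadraticTwist (NumberField.discr K : ℚ)).entireLFunction 1 ≠ 0 ∧
                analyticRankEK W K = W.analyticRank := by
  intro W _ hrank hsha
  haveI : Fact (Nat.Prime 3) := ⟨Nat.prime_three⟩
  obtain ⟨K, _, _, hK, -, hHN, hH3, -, hL, -, -, han⟩ :=
    exists_heegnerField_descent_of_mordellWeilRank_eq_one_of_finite_sha hpar hmod hHL hKato W 3
      hrank hsha 0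
  exact ⟨K, inferInstance, inferInstance, hK, hHN, hH3, hL, han⟩

/-! ## 3. `stub_grossZagierCloser` — modulo two refereed facts -/

/-- **`stub_grossZagierCloser` of the v2 cut from refereed facts** (statement after the binders =
the stub, token for token): for a globally minimal elliptic `W/ℚ` of conductor `N` and an imaginary
quadratic `K` with the Heegner hypothesis for `N`, if every Heegner point of level `N` in `W(K)` has
infinite order then `ord_{s=1} L(W/K, s) = 1` — granted the existence of a Heegner point (`hHP`,
`exists_isHeegnerPoint`, Gross 1984) and Gross–Zagier's criterion (`hGZ`,
`analyticRankEK_eq_one_iff_heegner_nonTorsion`, Gross–Zagier 1986 Thm. I.6.3 with Kolyvagin).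
[cite: Gross1984, §§3–4] [cite: GrossZagier1986, Thm. I.6.3 with V.§2] -/
theorem grossZagierCloser_of_facts
    (hHP : ∀ (W : WeierstrassCurve ℚ) (K : Type) [Field K] [NumberField K],
      exists_isHeegnerPoint W K)
    (hGZ : ∀ (W : WeierstrassCurve ℚ) (N : ℕ) [NeZero N] (K : Type) [Field K] [NumberField K],
      analyticRankEK_eq_one_iff_heegner_nonTorsion W N K) :
    ∀ (W : WeierstrassCurve ℚ) [W.IsElliptic] [W.IsGloballyMinimal] (K : Type) [Field K]
      [NumberField K] (N : ℕ) [NeZero N], W.conductorNorm ℤ = N → IsImaginaryQuadratic K →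
        SatisfiesHeegnerHypothesis N K →
          (∀ (P : (W.baseChange K).toAffine.Point), IsHeegnerPoint N W K P → ¬ IsOfFinAddOrder P) →
            analyticRankEK W K = 1 := by
  intro W _ _ K _ _ N _ hN hK hH hall
  subst hN
  obtain ⟨P, hP⟩ := hHP W K hK hH
  exact (hGZ W _ K hK rfl hH hP).mpr (hall P hP)

/-! ## 4. The v2 composition: crux B modulo `stub_heegnerNonTorsion` and six refereed facts -/

/-- **Crux B modulo the v2 research stub and six refereed facts.** Granted `3`-parity (`hpar`),
Modularity (`hmod`), Hoffstein–Luo (`hHL`), Kato (`hKato`), the existence of Heegner points (`hHP`)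
and Gross–Zagier's criterion (`hGZ`), the statement `stub_heegnerNonTorsion` of the v2 cut (`hNT`,
verbatim: for a globally minimal elliptic `W/ℚ` with `j(W) = 0`, an imaginary quadratic `K` with the
Heegner hypothesis for `N = N(W)`, `3` split in `K` and `L(W^{(d_K)}, 1) ≠ 0`, the hypotheses
`rank W(ℚ) = 1 ∧ #Ш(W/ℚ)[3^∞] < ∞` force every Heegner point of level `N` in `W(K)` to have infinite
order) gives `AnalyticRankOneOfRankOneFiniteShaThree`. Proof: the v2 composition with
`stub_minimalModelReduction`, `heegnerFieldSupply_of_facts` and `grossZagierCloser_of_facts`.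
[cite: GrossZagier1986, Thm. I.6.3 with V.§2] [cite: Gross1984, §§3–4] -/
theorem analyticRankOne_of_facts_of_heegnerNonTorsion
    (hpar : ∀ (W : WeierstrassCurve ℚ) [W.IsElliptic] (p : ℕ) [Fact p.Prime], p_parity W p)
    (hmod : ModularForms.exists_isNewformOf) (hHL : HoffsteinLuo1997_exists_twist_L_one_ne_zero)
    (hKato : ∀ (W : WeierstrassCurve ℚ) [W.IsElliptic] (p : ℕ) [Fact p.Prime],
      kato_finite_of_L_one_ne_zero W p)
    (hHP : ∀ (W : WeierstrassCurve ℚ) (K : Type) [Field K] [NumberField K],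
      exists_isHeegnerPoint W K)
    (hGZ : ∀ (W : WeierstrassCurve ℚ) (N : ℕ) [NeZero N] (K : Type) [Field K] [NumberField K],
      analyticRankEK_eq_one_iff_heegner_nonTorsion W N K)
    (hNT : ∀ (W : WeierstrassCurve ℚ) [W.IsElliptic] [W.IsGloballyMinimal], W.j = 0 →
      ∀ (K : Type) [Field K] [NumberField K] (N : ℕ) [NeZero N], W.conductorNorm ℤ = N →
        IsImaginaryQuadratic K → SatisfiesHeegnerHypothesis N K → SatisfiesHeegnerHypothesis 3 K →
          (W.quadraticTwist (NumberField.discr K : ℚ)).entireLFunction 1 ≠ 0 →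
            W.mordellWeilRank = 1 → Finite (AddCommGroup.primaryComponent W.sha 3) →
              ∀ (P : (W.baseChange K).toAffine.Point), IsHeegnerPoint N W K P →
                ¬ IsOfFinAddOrder P) :
    Summit.BirchSwinnertonDyer.BirchSwinnertonDyer.Theses.MordellShaFreeCut.AnalyticRankOneOfRankOneFiniteShaThree := by
  intro D hD hr hfin
  refine stub_minimalModelReduction ?_ hD hr hfin
  intro W _ _ hj hrW hfinW
  obtain ⟨K, _, _, hK, hHN, hH3, hL, hfac⟩ := heegnerFieldSupply_of_facts hpar hmod hHL hKato W hrW hfinW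
  haveI : NeZero (W.conductorNorm ℤ) := ⟨(W.conductorNorm_pos_holds).ne'⟩
  have hNT' := hNT W hj K (W.conductorNorm ℤ) rfl hK hHN hH3 hL hrW hfinW
  have h1 := grossZagierCloser_of_facts hHP hGZ W K (W.conductorNorm ℤ) rfl hK hHN hNT'
  rwa [hfac] at h1

/-! ## 5. Conversely: crux B ⟹ the v2 research stub (Modularity + Gross–Zagier) -/

/-- **Every elliptic curve over `ℚ` with `j = 0` is `ℚ`-isomorphic to a Mordell curve**: a short
normal form `C • W : y² = x³ + a₄ x + a₆` exists (`2, 3` invertible; Mathlib `toShortNF`), its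
`c₄ = −48 a₄` (`c₄_of_isShortNF`) vanishes since `j = 0` (`j_eq_zero_iff`), so `a₄ = 0` and
`C • W = mordellCurve a₆`. [cite: SilvermanAEC2009, III.1 (short Weierstrass form) with Prop. III.1.4(c)] -/
theorem exists_variableChange_eq_mordellCurve_of_j_eq_zero (W : WeierstrassCurve ℚ) [W.IsElliptic]
    (hj : W.j = 0) : ∃ (C : VariableChange ℚ) (D : ℚ), C • W = mordellCurve D := by
  haveI : Invertible (2 : ℚ) := invertibleOfNonzero (by norm_num)
  haveI : Invertible (3 : ℚ) := invertibleOfNonzero (by norm_num)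
  refine ⟨W.toShortNF, (W.toShortNF • W).a₆, ?_⟩
  haveI : (W.toShortNF • W).IsShortNF := W.toShortNF_spec
  have hj' : (W.toShortNF • W).j = 0 := by rw [variableChange_j]; exact hj
  have hc₄ : (W.toShortNF • W).c₄ = 0 := ((W.toShortNF • W).j_eq_zero_iff).mp hj'
  have ha₄ : (W.toShortNF • W).a₄ = 0 := by
    rw [(W.toShortNF • W).c₄_of_isShortNF] at hc₄
    have : (-48 : ℚ) ≠ 0 := by norm_num
    exact (mul_eq_zero.mp hc₄).resolve_left this
  ext
  · exact (W.toShortNF • W).a₁_of_isShortNF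
  · exact (W.toShortNF • W).a₂_of_isShortNF
  · exact (W.toShortNF • W).a₃_of_isShortNF
  · exact ha₄
  · rfl

/-- **Crux B ⟹ `stub_heegnerNonTorsion` of the v2 cut** (statement after the binders = the stub,
token for token), modulo Modularity (`hmod`) and Gross–Zagier's criterion (`hGZ`). Given the stub's
data — `W` globally minimal with `j = 0`, `K` with the Heegner hypothesis for `N = N(W)`,
`L(W^{(d_K)}, 1) ≠ 0`, `rank W(ℚ) = 1`, `#Ш(W/ℚ)[3^∞] < ∞`, a Heegner point `P` of level `N` — write
`C • W = E_D` (`exists_variableChange_eq_mordellCurve_of_j_eq_zero`; `D ≠ 0` as `E_D` is elliptic),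
transport rank / `Ш[3^∞]` / analytic rank along `C`, apply crux B (`hB`) to get
`ord_{s=1} L(W, s) = 1`; the twist has analytic rank `0`
(`analyticRank_eq_zero_of_entireLFunction_one_ne_zero`); Artin formalism (`analyticRankEK_eq_add_of`)
gives `ord_{s=1} L(W/K, s) = 1`; `hGZ` makes `P` non-torsion. The Heegner hypothesis at `3` is not
used. [cite: GrossZagier1986, Thm. I.6.3 with V.§2 and I.§7] -/
theorem heegnerNonTorsion_of_crux (hmod : ModularForms.exists_isNewformOf)
    (hGZ : ∀ (W : WeierstrassCurve ℚ) (N : ℕ) [NeZero N] (K : Type) [Field K] [NumberField K],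
      analyticRankEK_eq_one_iff_heegner_nonTorsion W N K)
    (hB : Summit.BirchSwinnertonDyer.BirchSwinnertonDyer.Theses.MordellShaFreeCut.AnalyticRankOneOfRankOneFiniteShaThree) :
    ∀ (W : WeierstrassCurve ℚ) [W.IsElliptic] [W.IsGloballyMinimal], W.j = 0 →
      ∀ (K : Type) [Field K] [NumberField K] (N : ℕ) [NeZero N], W.conductorNorm ℤ = N →
        IsImaginaryQuadratic K → SatisfiesHeegnerHypothesis N K → SatisfiesHeegnerHypothesis 3 K →
          (W.quadraticTwist (NumberField.discr K : ℚ)).entireLFunction 1 ≠ 0 →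
            W.mordellWeilRank = 1 → Finite (AddCommGroup.primaryComponent W.sha 3) →
              ∀ (P : (W.baseChange K).toAffine.Point), IsHeegnerPoint N W K P →
                ¬ IsOfFinAddOrder P := by
  intro W _ _ hj K _ _ N _ hN hK hHN _ hL hrank hsha P hP
  -- `W ≅ E_D` over `ℚ`
  obtain ⟨C, D, hCD⟩ := exists_variableChange_eq_mordellCurve_of_j_eq_zero W hj
  haveI hE : (mordellCurve D).IsElliptic := by rw [← hCD]; infer_instance
  have hD : D ≠ 0 := by
    intro hD0
    have hΔ : (mordellCurve D).Δ ≠ 0 := by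
      rw [← WeierstrassCurve.coe_Δ']; exact (mordellCurve D).Δ'.ne_zero
    rw [mordellCurve_Δ, hD0] at hΔ
    norm_num at hΔ
  -- crux B on `E_D`, transported back to `W`
  have h1 : W.analyticRank = 1 := by
    have hr' : (mordellCurve D).mordellWeilRank = 1 := by
      rw [← hCD, mordellWeilRank_variableChange_holds]; exact hrank
    haveI := hsha
    have hfin' : Finite (AddCommGroup.primaryComponent (mordellCurve D).sha 3) := by
      rw [← hCD]; exact WeierstrassCurve.finite_primaryComponent_sha_variableChange W C 3
    have h := hB hD hr' hfin'
    rwa [← hCD, analyticRank_variableChange_holds W C] at h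
  -- the twist has analytic rank `0`; Artin formalism; Gross–Zagier
  have hd : (NumberField.discr K : ℚ) ≠ 0 := by exact_mod_cast NumberField.discr_ne_zero K
  haveI := W.isElliptic_quadraticTwist hd
  have h0 : (W.quadraticTwist (NumberField.discr K : ℚ)).analyticRank = 0 :=
    analyticRank_eq_zero_of_entireLFunction_one_ne_zero _ hL
  have hEK : analyticRankEK W K = 1 := by
    rw [analyticRankEK_eq_add_of (hasEntireLFunction_rat_of_exists_isNewformOf hmod) W K, h1, h0]
  exact (hGZ W N K hK hN hHN hP).mp hEK

end Summit.BirchSwinnertonDyer.BirchSwinnertonDyer.Theorems.MordellShaFreeCutOfHeegnerNonTorsion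

end
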